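import Summits.Ventures.PercRepro.C041AnchorGlueSets
import Summits.Ventures.PercRepro.C041SixVec
import Summits.Ventures.PercRepro.C041TriangleCone

/-!
# ROW C-041 — THE SIX-VECTOR IS MULTIPLICATIVE OVER BLOCKS AT THE ANCHOR (p6, gen 29; mine-3's C-041.md
§20 (b)(3))

Setting of `C041AnchorGlue(Sets)`: the zones `Z₂`, `Z₃` glued at their anchors.  A state of the glued zone is a
pair of states (`stateEquiv`), and each of the six count sets of the glued zone at the anchor is the product of the
two sides' (`card_Fset_glue`, …: the anchor's merged sub-zone is all red / without blue `2`-mark / without blue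
`1`-mark / invalid iff both halves are, and then the cross-admissibility condition of `adm_iff` is vacuous).  Hence
**`sixVec_glue : Π(Z₂ ∪_a Z₃) = Π(Z₂) * Π(Z₃)`** (pointwise), and with mine-3's `InCone.mul` (`C041TriangleCone`) the
cone is closed under gluing at the anchor (`inCone_sixVec_glue`), which gives (P), the one-anchor (CS) and the ZONE
O-CUBE on the glued zone (`zoneOCubeConj_glue`) — the «gluing at the anchor» step of the class 𝒵 of §20 (b)(3),
in the six-vector form that carries it.
-/

namespace PercRepro

namespace ZoneZ

namespace AnchorGlue

open ZoneData Pendant TreeClosure Finset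

universe u₁ u₂ u₃ u₄ u₅ u₆ u₇ u₈

variable {V₂ : Type u₁} {E₂ : Type u₂} {S₁ : Type u₃} {S₂ : Type u₄} {V₃ : Type u₅} {E₃ : Type u₆}
  {R₁ : Type u₇} {R₂ : Type u₈}
variable (Z₂ : ZoneData V₂ E₂ S₁ S₂) (a₂ : V₂) (Z₃ : ZoneData V₃ E₃ R₁ R₂) (a₃ : V₃)

/-! ## The states of the glued zone -/

/-- The states of the glued zone are the pairs of states. -/
def stateEquiv : State (E₂ ⊕ E₃) (S₁ ⊕ R₁) (S₂ ⊕ R₂) ≃ State E₂ S₁ S₂ × State E₃ R₁ R₂ where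
  toFun σ := (restrL σ, restrR σ)
  invFun p := (Sum.elim p.1.1 p.2.1, Sum.elim p.1.2.1 p.2.2.1, Sum.elim p.1.2.2 p.2.2.2)
  left_inv σ := by
    obtain ⟨c, m₁, m₂⟩ := σ
    refine Prod.ext ?_ (Prod.ext ?_ ?_)
    · funext e
      rcases e with e | e <;> rfl
    · funext t
      rcases t with t | t <;> rfl
    · funext t
      rcases t with t | t <;> rfl
  right_inv p := by
    obtain ⟨⟨c, m₁, m₂⟩, ⟨c', m₁', m₂'⟩⟩ := p
    rfl

/-- The equivalence, applied. -/
theorem stateEquiv_apply (σ : State (E₂ ⊕ E₃) (S₁ ⊕ R₁) (S₂ ⊕ R₂)) : stateEquiv σ = (restrL σ, restrR σ) := rfl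

section Counts

variable [Fintype E₂] [DecidableEq E₂] [Fintype S₁] [DecidableEq S₁] [Fintype S₂] [DecidableEq S₂]
  [Fintype E₃] [DecidableEq E₃] [Fintype R₁] [DecidableEq R₁] [Fintype R₂] [DecidableEq R₂]

/-- A filter on a product by a conjunction of conditions on the factors. -/
theorem card_filter_prod {α β : Type*} [Fintype α] [Fintype β] (P : α → Prop) (Q : β → Prop)
    [DecidablePred P] [DecidablePred Q] :
    #(univ.filter fun x : α × β => P x.1 ∧ Q x.2) = #(univ.filter P) * #(univ.filter Q) := by
  rw [← Finset.univ_product_univ, Finset.filter_product, Finset.card_product]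

/-- A count of the glued zone which splits as a conjunction of conditions on the two halves is a product. -/
theorem card_filter_eq_mul (Q : State (E₂ ⊕ E₃) (S₁ ⊕ R₁) (S₂ ⊕ R₂) → Prop) (P₂ : State E₂ S₁ S₂ → Prop)
    (P₃ : State E₃ R₁ R₂ → Prop) [DecidablePred Q] [DecidablePred P₂] [DecidablePred P₃]
    (h : ∀ σ, Q σ ↔ P₂ (restrL σ) ∧ P₃ (restrR σ)) :
    #(univ.filter Q) = #(univ.filter P₂) * #(univ.filter P₃) := by
  rw [← card_filter_prod P₂ P₃]
  refine Finset.card_equiv stateEquiv fun σ => ?_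
  rw [Finset.mem_filter, Finset.mem_filter]
  simp only [Finset.mem_univ, true_and, stateEquiv_apply]
  exact h σ

/-- `#F` multiplies. -/
theorem card_Fset_glue : #((glue Z₂ a₂ Z₃ a₃).Fset (Sum.inl a₂)) = #(Z₂.Fset a₂) * #(Z₃.Fset a₃) := by
  classical
  have e : (glue Z₂ a₂ Z₃ a₃).Fset (Sum.inl a₂) = univ.filter fun σ =>
      (glue Z₂ a₂ Z₃ a₃).adm σ ∧ Sum.inl a₂ ∉ (glue Z₂ a₂ Z₃ a₃).D σ ∧ Sum.inl a₂ ∉ (glue Z₂ a₂ Z₃ a₃).D2 σ := by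
    ext σ
    rw [mem_Fset, Finset.mem_filter]
    simp only [Finset.mem_univ, true_and]
  have e₂ : Z₂.Fset a₂ = univ.filter fun τ => Z₂.adm τ ∧ a₂ ∉ Z₂.D τ ∧ a₂ ∉ Z₂.D2 τ := by
    ext τ
    rw [mem_Fset, Finset.mem_filter]
    simp only [Finset.mem_univ, true_and]
  have e₃ : Z₃.Fset a₃ = univ.filter fun τ => Z₃.adm τ ∧ a₃ ∉ Z₃.D τ ∧ a₃ ∉ Z₃.D2 τ := by
    ext τ
    rw [mem_Fset, Finset.mem_filter]
    simp only [Finset.mem_univ, true_and]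
  rw [e, e₂, e₃]
  refine card_filter_eq_mul _ _ _ fun σ => ?_
  rw [adm_iff, inl_a_mem_D_iff, inl_a_mem_D2_iff]
  tauto

/-- `#(F + T₁)` multiplies. -/
theorem card_FAset_glue : #((glue Z₂ a₂ Z₃ a₃).FAset (Sum.inl a₂)) = #(Z₂.FAset a₂) * #(Z₃.FAset a₃) := by
  classical
  have e : (glue Z₂ a₂ Z₃ a₃).FAset (Sum.inl a₂) = univ.filter fun σ =>
      (glue Z₂ a₂ Z₃ a₃).adm σ ∧ Sum.inl a₂ ∉ (glue Z₂ a₂ Z₃ a₃).D2 σ := by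
    ext σ
    rw [mem_FAset, Finset.mem_filter]
    simp only [Finset.mem_univ, true_and]
  have e₂ : Z₂.FAset a₂ = univ.filter fun τ => Z₂.adm τ ∧ a₂ ∉ Z₂.D2 τ := by
    ext τ
    rw [mem_FAset, Finset.mem_filter]
    simp only [Finset.mem_univ, true_and]
  have e₃ : Z₃.FAset a₃ = univ.filter fun τ => Z₃.adm τ ∧ a₃ ∉ Z₃.D2 τ := by
    ext τ
    rw [mem_FAset, Finset.mem_filter]
    simp only [Finset.mem_univ, true_and]
  rw [e, e₂, e₃]
  refine card_filter_eq_mul _ _ _ fun σ => ?_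
  rw [adm_iff, inl_a_mem_D2_iff]
  tauto

/-- `#(F + T₂)` multiplies. -/
theorem card_FBset_glue : #((glue Z₂ a₂ Z₃ a₃).FBset (Sum.inl a₂)) = #(Z₂.FBset a₂) * #(Z₃.FBset a₃) := by
  classical
  have e : (glue Z₂ a₂ Z₃ a₃).FBset (Sum.inl a₂) = univ.filter fun σ =>
      (glue Z₂ a₂ Z₃ a₃).adm σ ∧ Sum.inl a₂ ∉ (glue Z₂ a₂ Z₃ a₃).D σ := by
    ext σ
    rw [mem_FBset, Finset.mem_filter]
    simp only [Finset.mem_univ, true_and]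
  have e₂ : Z₂.FBset a₂ = univ.filter fun τ => Z₂.adm τ ∧ a₂ ∉ Z₂.D τ := by
    ext τ
    rw [mem_FBset, Finset.mem_filter]
    simp only [Finset.mem_univ, true_and]
  have e₃ : Z₃.FBset a₃ = univ.filter fun τ => Z₃.adm τ ∧ a₃ ∉ Z₃.D τ := by
    ext τ
    rw [mem_FBset, Finset.mem_filter]
    simp only [Finset.mem_univ, true_and]
  rw [e, e₂, e₃]
  refine card_filter_eq_mul _ _ _ fun σ => ?_
  rw [adm_iff, inl_a_mem_D_iff]
  tauto

/-- `#I_F` multiplies. -/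
theorem card_IFset_glue : #((glue Z₂ a₂ Z₃ a₃).IFset (Sum.inl a₂)) = #(Z₂.IFset a₂) * #(Z₃.IFset a₃) := by
  classical
  have e : (glue Z₂ a₂ Z₃ a₃).IFset (Sum.inl a₂) = univ.filter fun σ =>
      (glue Z₂ a₂ Z₃ a₃).adm σ ∧ (glue Z₂ a₂ Z₃ a₃).blueK {Sum.inl a₂} σ ∧
        Sum.inl a₂ ∉ (glue Z₂ a₂ Z₃ a₃).D σ ∧ Sum.inl a₂ ∉ (glue Z₂ a₂ Z₃ a₃).D2 σ := by
    ext σ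
    rw [mem_IFset, Finset.mem_filter]
    simp only [Finset.mem_univ, true_and]
  have e₂ : Z₂.IFset a₂ = univ.filter fun τ => Z₂.adm τ ∧ Z₂.blueK {a₂} τ ∧ a₂ ∉ Z₂.D τ ∧ a₂ ∉ Z₂.D2 τ := by
    ext τ
    rw [mem_IFset, Finset.mem_filter]
    simp only [Finset.mem_univ, true_and]
  have e₃ : Z₃.IFset a₃ = univ.filter fun τ => Z₃.adm τ ∧ Z₃.blueK {a₃} τ ∧ a₃ ∉ Z₃.D τ ∧ a₃ ∉ Z₃.D2 τ := by
    ext τ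
    rw [mem_IFset, Finset.mem_filter]
    simp only [Finset.mem_univ, true_and]
  rw [e, e₂, e₃]
  refine card_filter_eq_mul _ _ _ fun σ => ?_
  rw [adm_iff, blueK_iff, inl_a_mem_D_iff, inl_a_mem_D2_iff]
  tauto

/-- `#(I_F + I₁)` multiplies. -/
theorem card_IAset_glue : #((glue Z₂ a₂ Z₃ a₃).IAset (Sum.inl a₂)) = #(Z₂.IAset a₂) * #(Z₃.IAset a₃) := by
  classical
  have e : (glue Z₂ a₂ Z₃ a₃).IAset (Sum.inl a₂) = univ.filter fun σ =>
      (glue Z₂ a₂ Z₃ a₃).adm σ ∧ (glue Z₂ a₂ Z₃ a₃).blueK {Sum.inl a₂} σ ∧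
        Sum.inl a₂ ∉ (glue Z₂ a₂ Z₃ a₃).D2 σ := by
    ext σ
    rw [mem_IAset, Finset.mem_filter]
    simp only [Finset.mem_univ, true_and]
  have e₂ : Z₂.IAset a₂ = univ.filter fun τ => Z₂.adm τ ∧ Z₂.blueK {a₂} τ ∧ a₂ ∉ Z₂.D2 τ := by
    ext τ
    rw [mem_IAset, Finset.mem_filter]
    simp only [Finset.mem_univ, true_and]
  have e₃ : Z₃.IAset a₃ = univ.filter fun τ => Z₃.adm τ ∧ Z₃.blueK {a₃} τ ∧ a₃ ∉ Z₃.D2 τ := by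
    ext τ
    rw [mem_IAset, Finset.mem_filter]
    simp only [Finset.mem_univ, true_and]
  rw [e, e₂, e₃]
  refine card_filter_eq_mul _ _ _ fun σ => ?_
  rw [adm_iff, blueK_iff, inl_a_mem_D2_iff]
  tauto

/-- `#(I_F + I₂)` multiplies. -/
theorem card_IBset_glue : #((glue Z₂ a₂ Z₃ a₃).IBset (Sum.inl a₂)) = #(Z₂.IBset a₂) * #(Z₃.IBset a₃) := by
  classical
  have e : (glue Z₂ a₂ Z₃ a₃).IBset (Sum.inl a₂) = univ.filter fun σ =>
      (glue Z₂ a₂ Z₃ a₃).adm σ ∧ (glue Z₂ a₂ Z₃ a₃).blueK {Sum.inl a₂} σ ∧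
        Sum.inl a₂ ∉ (glue Z₂ a₂ Z₃ a₃).D σ := by
    ext σ
    rw [mem_IBset, Finset.mem_filter]
    simp only [Finset.mem_univ, true_and]
  have e₂ : Z₂.IBset a₂ = univ.filter fun τ => Z₂.adm τ ∧ Z₂.blueK {a₂} τ ∧ a₂ ∉ Z₂.D τ := by
    ext τ
    rw [mem_IBset, Finset.mem_filter]
    simp only [Finset.mem_univ, true_and]
  have e₃ : Z₃.IBset a₃ = univ.filter fun τ => Z₃.adm τ ∧ Z₃.blueK {a₃} τ ∧ a₃ ∉ Z₃.D τ := by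
    ext τ
    rw [mem_IBset, Finset.mem_filter]
    simp only [Finset.mem_univ, true_and]
  rw [e, e₂, e₃]
  refine card_filter_eq_mul _ _ _ fun σ => ?_
  rw [adm_iff, blueK_iff, inl_a_mem_D_iff]
  tauto

/-- **THE SIX-VECTOR IS MULTIPLICATIVE OVER BLOCKS AT THE ANCHOR**: `Π(Z₂ ∪_a Z₃) = Π(Z₂) * Π(Z₃)`. -/
theorem sixVec_glue : (glue Z₂ a₂ Z₃ a₃).sixVec (Sum.inl a₂) = Z₂.sixVec a₂ * Z₃.sixVec a₃ := by
  funext i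
  rw [Pi.mul_apply]
  fin_cases i
  · show (glue Z₂ a₂ Z₃ a₃).sixVec (Sum.inl a₂) 0 = Z₂.sixVec a₂ 0 * Z₃.sixVec a₃ 0
    rw [sixVec_zero, sixVec_zero, sixVec_zero, card_Fset_glue, Nat.cast_mul]
  · show (glue Z₂ a₂ Z₃ a₃).sixVec (Sum.inl a₂) 1 = Z₂.sixVec a₂ 1 * Z₃.sixVec a₃ 1
    rw [sixVec_one, sixVec_one, sixVec_one, card_FAset_glue, Nat.cast_mul]
  · show (glue Z₂ a₂ Z₃ a₃).sixVec (Sum.inl a₂) 2 = Z₂.sixVec a₂ 2 * Z₃.sixVec a₃ 2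
    rw [sixVec_two, sixVec_two, sixVec_two, card_FBset_glue, Nat.cast_mul]
  · show (glue Z₂ a₂ Z₃ a₃).sixVec (Sum.inl a₂) 3 = Z₂.sixVec a₂ 3 * Z₃.sixVec a₃ 3
    rw [sixVec_three, sixVec_three, sixVec_three, card_IFset_glue, Nat.cast_mul]
  · show (glue Z₂ a₂ Z₃ a₃).sixVec (Sum.inl a₂) 4 = Z₂.sixVec a₂ 4 * Z₃.sixVec a₃ 4
    rw [sixVec_four, sixVec_four, sixVec_four, card_IAset_glue, Nat.cast_mul]
  · show (glue Z₂ a₂ Z₃ a₃).sixVec (Sum.inl a₂) 5 = Z₂.sixVec a₂ 5 * Z₃.sixVec a₃ 5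
    rw [sixVec_five, sixVec_five, sixVec_five, card_IBset_glue, Nat.cast_mul]

/-- **The cone is closed under gluing at the anchor.** -/
theorem inCone_sixVec_glue (h₂ : InCone (Z₂.sixVec a₂)) (h₃ : InCone (Z₃.sixVec a₃)) :
    InCone ((glue Z₂ a₂ Z₃ a₃).sixVec (Sum.inl a₂)) := by
  rw [sixVec_glue]
  exact InCone.mul h₂ h₃

/-- (P) on the glued zone from cone membership of the two sides. -/
theorem K4_glue (h₂ : InCone (Z₂.sixVec a₂)) (h₃ : InCone (Z₃.sixVec a₃)) :
    K4 (#((glue Z₂ a₂ Z₃ a₃).Fset (Sum.inl a₂)) : ℝ) (#((glue Z₂ a₂ Z₃ a₃).T1set (Sum.inl a₂)))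
      (#((glue Z₂ a₂ Z₃ a₃).T2set (Sum.inl a₂))) (#((glue Z₂ a₂ Z₃ a₃).Iset (Sum.inl a₂))) :=
  (glue Z₂ a₂ Z₃ a₃).K4_of_inCone_sixVec (Sum.inl a₂) (inCone_sixVec_glue Z₂ a₂ Z₃ a₃ h₂ h₃)

/-- The one-anchor (CS) on the glued zone from cone membership of the two sides. -/
theorem zoneCSConj_glue (h₂ : InCone (Z₂.sixVec a₂)) (h₃ : InCone (Z₃.sixVec a₃)) :
    (glue Z₂ a₂ Z₃ a₃).ZoneCSConj {Sum.inl a₂} (∅ : Set (V₂ ⊕ V₃)) :=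
  (glue Z₂ a₂ Z₃ a₃).zoneCSConj_of_inCone_sixVec (Sum.inl a₂) (inCone_sixVec_glue Z₂ a₂ Z₃ a₃ h₂ h₃)

/-- **The ZONE O-CUBE on two cone members glued at the anchor.** -/
theorem zoneOCubeConj_glue (h₂ : InCone (Z₂.sixVec a₂)) (h₃ : InCone (Z₃.sixVec a₃)) :
    (glue Z₂ a₂ Z₃ a₃).ZoneOCubeConj {Sum.inl a₂} (∅ : Set (V₂ ⊕ V₃)) :=
  (glue Z₂ a₂ Z₃ a₃).zoneOCubeConj_of_inCone_sixVec (Sum.inl a₂) (inCone_sixVec_glue Z₂ a₂ Z₃ a₃ h₂ h₃)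

end Counts

end AnchorGlue

end ZoneZ

end PercRepro
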